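import Mathlib.Analysis.Distribution.SchwartzSpace.Fourier
import Mathlib.Analysis.InnerProductSpace.Dual
import Mathlib.MeasureTheory.Measure.Haar.Unique
import HarnessLib

/-!
# The Fourier transform of a Schwartz function for an arbitrary non-degenerate pairing is Schwartz

`Literature/Analysis/Distribution` support file (everything proved). Mathlib's Fourier transform of
Schwartz functions (`SchwartzMap.fourierTransformCLM`) is set up on a finite-dimensional real inner
product space `V` with its volume, `𝓕 f (w) = ∫ 𝐞(-⟪v, w⟫) f(v) dv`. In the adelic applications
the archimedean vector space `E = (K ⊗_ℚ ℝ)^ι` comes with the *trace pairing*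
`B(v, w) = Σ_i Tr(v_i w_i)` and an arbitrary additive Haar measure instead; this file transports
Mathlib's theorem to that setting:

* `exists_continuousLinearEquiv_bilinForm_eq_inner` — a non-degenerate bilinear form `B` on a
  finite-dimensional real normed space `E` is `B(v, w) = ⟪T v, S w⟫` for two linear isomorphisms
  `T, S : E ≃ ℝ^d` (Riesz representation in the Euclidean model);
* `SchwartzMap.exists_eq_integral_fourierChar_bilinForm` — **for `f ∈ 𝓢(E, F)`, an additive Haar
  measure `μ` on `E` and a non-degenerate bilinear form `B`, the function
  `w ↦ ∫ 𝐞(-B(v, w)) f(v) dμ(v)` is a Schwartz function on `E`** (it is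
  `c · (𝓕 (f ∘ T⁻¹)) ∘ S` with `c` the Haar scalar factor of `T_* μ` against the volume of `ℝ^d`;
  Mathlib `SchwartzMap.fourierTransformCLM`, `SchwartzMap.compCLMOfContinuousLinearEquiv`,
  `MeasureTheory.Measure.isAddLeftInvariant_eq_smul`).

This is the archimedean half of "the Fourier transform preserves the Schwartz–Bruhat space of
`𝔸_K^ι`" (Tate (1967), §3.2 at the real and complex places; Godement–Jacquet, LNM 260, §11, the
space `𝒮(M_n(𝔸))` is stable under `Φ ↦ Φ̂`), consumed by the Poisson summation on `M_n(𝔸_K)` in the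
discharge of `GodementJacquet1972_gjZeta_meromorphic`. [folklore]

## References

* J. Tate, in Cassels–Fröhlich (eds.), *Algebraic Number Theory* (1967), Ch. XV, §2.2, §3.2
  [CasselsFrohlichANT1967].
* L. Hörmander, *The Analysis of Linear Partial Differential Operators I*, Thm. 7.1.5 (the
  Fourier transform is an isomorphism of `𝒮`) [folklore].
-/

noncomputable section

open MeasureTheory MeasureTheory.Measure Real
open scoped FourierTransform SchwartzMap RealInnerProductSpace ENNReal NNReal

namespace Literature.Analysis.Distribution

variable {E : Type*} [NormedAddCommGroup E] [NormedSpace ℝ E] [FiniteDimensional ℝ E]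

/-- **A non-degenerate bilinear form is an inner product up to two linear isomorphisms**: for a
non-degenerate bilinear form `B` on a finite-dimensional real normed space `E` of dimension `d`
there are linear isomorphisms `T, S : E ≃ ℝ^d` with `B(v, w) = ⟪T v, S w⟫` for all `v, w` (`T` any
isomorphism, `S w` the Riesz representative of `x ↦ B(T⁻¹ x, w)`; `S` is injective by
non-degeneracy, hence bijective). [folklore] -/
theorem exists_continuousLinearEquiv_bilinForm_eq_inner (B : LinearMap.BilinForm ℝ E)
    (hB : B.Nondegenerate) :
    ∃ T S : E ≃L[ℝ] EuclideanSpace ℝ (Fin (Module.finrank ℝ E)),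
      ∀ v w, B v w = ⟪T v, S w⟫ := by
  set V := EuclideanSpace ℝ (Fin (Module.finrank ℝ E)) with hV
  have hdim : Module.finrank ℝ E = Module.finrank ℝ V :=
    (finrank_euclideanSpace_fin (𝕜 := ℝ) (n := Module.finrank ℝ E)).symm
  set T : E ≃L[ℝ] V := ContinuousLinearEquiv.ofFinrankEq hdim with hT
  -- the Riesz representative of `x ↦ B (T⁻¹ x) w`
  set φ : E →ₗ[ℝ] (V →L[ℝ] ℝ) :=
    { toFun := fun w => LinearMap.toContinuousLinearMap ((B.flip w).comp T.symm.toLinearMap)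
      map_add' := fun w w' => by
        ext x
        simp
      map_smul' := fun c w => by
        ext x
        simp } with hφ
  have hφapply : ∀ w x, φ w x = B (T.symm x) w := fun w x => rfl
  set S₀ : E →ₗ[ℝ] V :=
    ((InnerProductSpace.toDual ℝ V).symm.toLinearEquiv.toLinearMap).comp φ with hS₀
  have hS₀ : ∀ v w, B v w = ⟪T v, S₀ w⟫ := by
    intro v w
    rw [real_inner_comm, hS₀, LinearMap.comp_apply]
    change B v w = ⟪(InnerProductSpace.toDual ℝ V).symm (φ w), T v⟫
    rw [InnerProductSpace.toDual_symm_apply, hφapply, ContinuousLinearEquiv.symm_apply_apply]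
  -- `S₀` is injective by non-degeneracy
  have hinj : Function.Injective S₀ := by
    rw [← LinearMap.ker_eq_bot, LinearMap.ker_eq_bot']
    intro w hw
    refine hB.2 w fun v => ?_
    rw [hS₀, hw, inner_zero_right]
  set S : E ≃L[ℝ] V := (LinearMap.linearEquivOfInjective S₀ hinj hdim).toContinuousLinearEquiv
    with hS
  refine ⟨T, S, fun v w => ?_⟩
  rw [hS₀]
  rfl

variable [MeasurableSpace E] [BorelSpace E]
  {F : Type*} [NormedAddCommGroup F] [NormedSpace ℂ F]

/-- **The Fourier transform for a non-degenerate pairing and an arbitrary Haar measure preserves the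
Schwartz space.** For `f ∈ 𝓢(E, F)`, an additive Haar measure `μ` on the finite-dimensional real
space `E` and a non-degenerate bilinear form `B` on `E`, there is `g ∈ 𝓢(E, F)` with
`g(w) = ∫ 𝐞(-B(v, w)) f(v) dμ(v)` for all `w` (`𝐞(t) = exp(2πi t)`). With
`B(v, w) = ⟪T v, S w⟫` (`exists_continuousLinearEquiv_bilinForm_eq_inner`) and `T_* μ = c · vol`,
`g = c · (𝓕(f ∘ T⁻¹)) ∘ S`. [folklore] -/
theorem SchwartzMap.exists_eq_integral_fourierChar_bilinForm (μ : Measure E) [μ.IsAddHaarMeasure]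
    (B : LinearMap.BilinForm ℝ E) (hB : B.Nondegenerate) (f : 𝓢(E, F)) :
    ∃ g : 𝓢(E, F), ∀ w, g w = ∫ v, 𝐞 (-(B v w)) • f v ∂μ := by
  obtain ⟨T, S, hTS⟩ := exists_continuousLinearEquiv_bilinForm_eq_inner B hB
  set V := EuclideanSpace ℝ (Fin (Module.finrank ℝ E)) with hV
  -- transport `f` to the Euclidean model and take Mathlib's Fourier transform there
  set f' : 𝓢(V, F) := SchwartzMap.compCLMOfContinuousLinearEquiv ℂ T.symm f with hf'
  set g' : 𝓢(V, F) := SchwartzMap.fourierTransformCLM ℂ f' with hg'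
  set g'' : 𝓢(E, F) := SchwartzMap.compCLMOfContinuousLinearEquiv ℂ S g' with hg''
  -- `T_* μ` is a multiple of the volume
  set c : ℝ≥0 := (μ.map T).addHaarScalarFactor (volume : Measure V) with hc
  have hμ : μ.map T = c • (volume : Measure V) := isAddLeftInvariant_eq_smul _ _
  refine ⟨(c : ℝ) • g'', fun w => ?_⟩
  -- evaluate
  have hg''w : g'' w = ∫ x : V, 𝐞 (-⟪x, S w⟫) • f (T.symm x) := by
    rw [hg'', SchwartzMap.compCLMOfContinuousLinearEquiv_apply, Function.comp_apply, hg',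
      SchwartzMap.fourierTransformCLM_apply, SchwartzMap.fourier_coe, Real.fourier_eq]
    rfl
  rw [_root_.smul_apply, hg''w]
  -- change variables `v = T⁻¹ x` on the right
  have hchange : ∫ v, 𝐞 (-(B v w)) • f v ∂μ =
      ∫ x : V, 𝐞 (-⟪x, S w⟫) • f (T.symm x) ∂(μ.map T) := by
    rw [show (⇑T : E → V) = ⇑T.toHomeomorph.toMeasurableEquiv by
      rw [Homeomorph.toMeasurableEquiv_coe]; rfl, integral_map_equiv]
    refine integral_congr_ae (Filter.Eventually.of_forall fun v => ?_)
    simp only [Homeomorph.toMeasurableEquiv_coe, ContinuousLinearEquiv.coe_toHomeomorph,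
      ContinuousLinearEquiv.symm_apply_apply, hTS]
  rw [hchange, hμ, integral_smul_nnreal_measure, NNReal.smul_def]

end Literature.Analysis.Distribution
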